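import Mathlib.LinearAlgebra.Matrix.Notation
import Mathlib.LinearAlgebra.Matrix.Determinant.Basic
import Mathlib.LinearAlgebra.Matrix.Trace
import Mathlib.Topology.Algebra.Valued.ValuationTopology
import Mathlib.Tactic
import HarnessLib

/-!
# The regular representation of a quadratic order `R[τ]`, `τ² = u·τ + v`, and its conjugates by the shell representatives `diag(1, ϖ^m)`
# (Labesse–Langlands 1979 §2, p. 7 and formula (2.1) p. 8 — the ALGEBRA half, place-blind)

Topic `NumberTheory/LocalFields`; namespace `Literature.NumberTheory.LocalFields.QuadraticRegularRep`.  THEOREMS ONLY (no definition, no instance, no notation,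
no named fact, no `sorry`); Mathlib-only imports.  Cell `pub/hodgecm-mathlib` (D-0151), crux H413 = `stmt-HodgeConjecture-24833`; prepared by F0P3a-p08 (g15) as the
place-blind algebra behind A-p12 (g19)'s census «R1LL-WILD» §2 brick (W′3) «LEMMA U′-wild = LL (2.1): the class of `γ = a + bτ` at a shell-`m` vertex» (the dyadic
residue `RankOneUnstableTransferNonsplitCMERamifiedWild` of books row #159; LEAD F0P3a-plan (g10) T9-21 (1): the wild road is priced, not staffed — this file opens no
road and touches no registered text).  HONEST LABEL: HC_CM is proved only modulo the printed citations (the 2 remaining named inputs hLiu418, h413) until rung 0 closes;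
nothing printed is asserted here beyond elementary matrix algebra.

THE SETTING (LL79 §2 pp. 7–8).  `L = F(τ)` a quadratic extension, `{1, τ}` an `𝒪_F`-basis of `𝒪_L` with `τ² = u·τ + v` (`u, v ∈ 𝒪_F`; this ABSTRACT integral basis
covers the unramified, the tamely ramified AND both dyadic shapes `τ = √π`, `τ = (1 + √d)∕2` at once — A-p12's risk (r1)).  «γ = a + bτ corresponds to the matrix
`(a, bv; b, a + bu)`» (p. 7) — the matrix of multiplication by `γ` in the basis `{1, τ}` (columns = images of `1`, `τ`).  The double cosets `T(F)∖G(F)∕G(𝒪_F)` have the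
representatives `diag(1, ϖ^m)`, `m ≥ 0` (p. 8), and (2.1) reads `γ` at the shell-`m` representative as the conjugate `(a, b v ϖ^m; b ϖ^{−m}, a + b u)`.

CONTENTS (every statement about the explicit matrix `!![a, b * v; b, a + b * u]`, no `def`):
* §1 (any commutative ring) `regRep_mul` (closed form of the product = multiplication in `R[τ]`), `regRep_comm`, `det_regRep` (`= a² + abu − b²v = N(a + bτ)`),
  `trace_regRep` (`= 2a + bu = Tr(a + bτ)`), `regRep_eq_smul_one_add_smul`, `regRep_tau_sq` (`T² = u·T + v·1` for `T = !![0, v; 1, u]`), `regRep_one`,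
  and the conjugate-root bookkeeping `sub_conj_eq_mul` ∕ `tau_sub_conj_sq` (`(a + bτ) − (a + bτ̄) = b(τ − τ̄)`, `(τ − τ̄)² = u² + 4v` when `τ + τ̄ = u`, `ττ̄ = −v`).
* §2 (any field, `ϖ ≠ 0`) **`diagonal_inv_mul_regRep_mul_diagonal`**: `diag(1, (ϖ^m)⁻¹)·(a, bv; b, a+bu)·diag(1, ϖ^m) = (a, b v ϖ^m; b (ϖ^m)⁻¹, a + b u)` — LL (2.1)'s
  matrix; `diagonal_inv_mul_diagonal` (the two diagonals are inverse to each other).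
* §3 (any valued field, `0 < |ϖ| ≤ 1`, `a u v b` integral) **`forall_v_shellConj_le_one_iff`**: the shell-`m` conjugate is INTEGRAL iff `|b| ≤ |ϖ|^m` («`γ` fixes the
  vertex `𝒪 ⊕ ϖ^m𝒪` iff `m ≤ ord b`»: the fixed set is the ball of radius `ord b` about the root edge) and **`forall_v_shellConj_sub_le`**: two elements `a + bτ`,
  `a′ + b′τ` with `a ≡ a′` and `b ϖ^{−m} ≡ b′ ϖ^{−m}` modulo `ϖ^j` have shell-`m` conjugates congruent modulo `ϖ^j` ENTRYWISE — «the class at a shell-`m` vertex modulo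
  the level-`j` congruence subgroup depends on `γ` only through `(a, b ϖ^{−m}) mod 𝔭^j`» — no division by `2`, no residue-field squares (the dyadic-safe form of the
  tame road's «bit»).
* §4 (ED. 2, any field) the twist `Conj_y(S) := diag(1, y)⁻¹·S·diag(1, y)` (the `K`-renormalisation by the lift of `diag(1, y)` ∕ the partner's outer twist, LL (2.2)):
  `diagonal_inv_mul_fin_two_mul_diagonal` (`Conj_y (p, q; r, s) = (p, q y; r y⁻¹, s)`), `conjDiag_conjDiag` (`Conj_{y′} ∘ Conj_y = Conj_{y y′}`),
  **`diagonal_inv_mul_shellConj_mul_diagonal`** (`Conj_y` of the shell-`m` conjugate), `diagonal_inv_mul_regRep_mul_diagonal_mul` (the same as ONE conjugation by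
  `diag(1, ϖ^m y)`), and LL p. 9's `b`-free normal form `(a, b²v∕x; x, a + bu)`: `diagonal_inv_mul_shellConj_mul_diagonal_of_mul_eq` (`y·(r ϖ^n) = b` ⇒ lower-left
  entry `r ϖ^n (ϖ^m)⁻¹`), `conj_shellConj_eq_normalFormA` (`y = b ϖ^{−n}`), `conj_shellConj_eq_normalFormB` (`y = b ϖ^{−n} r⁻¹`).

## References
* [LabesseLanglands1979] J.-P. Labesse, R. P. Langlands, *L-indistinguishability for SL(2)*, Canad. J. Math. 31 (1979) 726–785: §2, p. 7 (the matrix of `γ = a + bτ`),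
  p. 8 (representatives `diag(1, ϖ^m)`, indices `δ_m`, formula (2.1)), p. 9 ((2.2): the partner ∕ `f(a, b²v∕x; x, a + bu)`).
* [Rogawski1990] J. D. Rogawski, *Automorphic Representations of Unitary Groups in Three Variables*, Ann. of Math. Stud. 123 (1990): §4.9 Lemma 4.9.3 p. 56 («the techniques
  of [LL] apply»).
-/

set_option autoImplicit false

open Matrix

namespace Literature.NumberTheory.LocalFields.QuadraticRegularRep

/-! ## §1 The regular representation of `R[τ]`, `τ² = u·τ + v` -/

section Ring

variable {R : Type*} [CommRing R] (u v : R)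

/-- **Product of two regular-representation matrices** = the regular representation of the product `(a + bτ)(a′ + b′τ) = (aa′ + bb′v) + (ab′ + ba′ + bb′u)τ`
(`τ² = uτ + v`). [cite: LabesseLanglands1979, §2 p. 7] -/
theorem regRep_mul (a b a' b' : R) :
    !![a, b * v; b, a + b * u] * !![a', b' * v; b', a' + b' * u] =
      !![a * a' + b * b' * v, (a * b' + b * a' + b * b' * u) * v;
         a * b' + b * a' + b * b' * u, (a * a' + b * b' * v) + (a * b' + b * a' + b * b' * u) * u] := by
  ext i j
  fin_cases i <;> fin_cases j <;> simp [Matrix.mul_apply, Fin.sum_univ_two] <;> ring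

/-- The regular-representation matrices **commute** (the order `R[τ]` is commutative). [cite: LabesseLanglands1979, §2 p. 7] -/
theorem regRep_comm (a b a' b' : R) :
    !![a, b * v; b, a + b * u] * !![a', b' * v; b', a' + b' * u] = !![a', b' * v; b', a' + b' * u] * !![a, b * v; b, a + b * u] := by
  rw [regRep_mul, regRep_mul]
  ext i j
  fin_cases i <;> fin_cases j <;> simp <;> ring

/-- **Determinant = norm**: `det (a, bv; b, a + bu) = a² + abu − b²v = N_{L∕F}(a + bτ)`. [cite: LabesseLanglands1979, §2 p. 7] -/
theorem det_regRep (a b : R) : (!![a, b * v; b, a + b * u]).det = a ^ 2 + a * b * u - b ^ 2 * v := by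
  rw [Matrix.det_fin_two_of]
  ring

/-- **Trace**: `tr (a, bv; b, a + bu) = 2a + bu = Tr_{L∕F}(a + bτ)`. [cite: LabesseLanglands1979, §2 p. 7] -/
theorem trace_regRep (a b : R) : (!![a, b * v; b, a + b * u]).trace = 2 * a + b * u := by
  rw [Matrix.trace_fin_two_of]
  ring

/-- The regular representation is `R`-linear in `(a, b)`: `(a, bv; b, a + bu) = a·1 + b·T` with `T = (0, v; 1, u)` the matrix of `τ`. [cite: LabesseLanglands1979, §2 p. 7] -/
theorem regRep_eq_smul_one_add_smul (a b : R) :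
    !![a, b * v; b, a + b * u] = a • (1 : Matrix (Fin 2) (Fin 2) R) + b • !![0, v; 1, u] := by
  ext i j
  fin_cases i <;> fin_cases j <;> simp

/-- The matrix `T = (0, v; 1, u)` of `τ` satisfies the defining relation **`T² = u·T + v·1`**. [cite: LabesseLanglands1979, §2 p. 7] -/
theorem regRep_tau_sq : !![(0 : R), v; 1, u] * !![0, v; 1, u] = u • !![(0 : R), v; 1, u] + v • (1 : Matrix (Fin 2) (Fin 2) R) := by
  ext i j
  fin_cases i <;> fin_cases j
  · simp [Matrix.mul_apply, Fin.sum_univ_two]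
  · simp [Matrix.mul_apply, Fin.sum_univ_two, mul_comm]
  · simp [Matrix.mul_apply, Fin.sum_univ_two]
  · simp [Matrix.mul_apply, Fin.sum_univ_two, mul_comm, add_comm]

/-- `a = 1`, `b = 0` gives the identity matrix (the regular representation of `1 ∈ R[τ]`). [cite: LabesseLanglands1979, §2 p. 7] -/
theorem regRep_one : !![(1 : R), 0 * v; 0, 1 + 0 * u] = 1 := by
  ext i j
  fin_cases i <;> fin_cases j <;> simp

/-- **Conjugate-root bookkeeping, I**: in any commutative ring containing `τ` and `τ̄`, `(a + bτ) − (a + bτ̄) = b·(τ − τ̄)` — so at a place `w` of `L`,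
`ord_w(γ − γ̄) = ord_w b + ord_w(τ − τ̄)` (the depth of the torus element is the valuation of `b` shifted by the different). [cite: LabesseLanglands1979, §2 p. 9] -/
theorem sub_conj_eq_mul {S : Type*} [CommRing S] (a b τ τ' : S) : (a + b * τ) - (a + b * τ') = b * (τ - τ') := by
  ring

/-- **Conjugate-root bookkeeping, II**: if `τ + τ̄ = u` and `τ·τ̄ = −v` (the two roots of `X² − uX − v`), then `(τ − τ̄)² = u² + 4v` (the discriminant).
[cite: LabesseLanglands1979, §2 p. 9] -/
theorem tau_sub_conj_sq {S : Type*} [CommRing S] {u v τ τ' : S} (hsum : τ + τ' = u) (hprod : τ * τ' = -v) :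
    (τ - τ') ^ 2 = u ^ 2 + 4 * v := by
  have h : (τ - τ') ^ 2 = (τ + τ') ^ 2 - 4 * (τ * τ') := by ring
  rw [h, hsum, hprod]
  ring

/-- The roots of `X² − uX − v`: if `τ² = uτ + v` then `τ̄ := u − τ` satisfies `τ + τ̄ = u`, `τ·τ̄ = −v` and `τ̄² = uτ̄ + v` (the conjugate `τ̄` of LL p. 9's `τ − τ̄`). [cite: LabesseLanglands1979, §2 p. 9] -/
theorem conj_root_of_sq_eq {S : Type*} [CommRing S] {u v τ : S} (hτ : τ ^ 2 = u * τ + v) :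
    τ + (u - τ) = u ∧ τ * (u - τ) = -v ∧ (u - τ) ^ 2 = u * (u - τ) + v := by
  refine ⟨by ring, ?_, ?_⟩
  · have : τ * (u - τ) = u * τ - τ ^ 2 := by ring
    rw [this, hτ]; ring
  · have : (u - τ) ^ 2 = u ^ 2 - 2 * u * τ + τ ^ 2 := by ring
    rw [this, hτ]; ring

end Ring

/-! ## §2 Conjugation by the shell representative `diag(1, ϖ^m)` (LL (2.1)) -/

section Field

variable {K : Type*} [Field K] (u v : K)

/-- `diag(1, c⁻¹)·diag(1, c) = 1` for `c ≠ 0` — the shell representative `diag(1, ϖ^m)` is invertible, so (2.1)'s matrix is a CONJUGATE of `γ`. [cite: LabesseLanglands1979, §2 p. 8] -/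
theorem diagonal_inv_mul_diagonal {c : K} (hc : c ≠ 0) :
    Matrix.diagonal ![(1 : K), c⁻¹] * Matrix.diagonal ![1, c] = 1 := by
  rw [Matrix.diagonal_mul_diagonal, ← Matrix.diagonal_one]
  congr 1
  funext i
  fin_cases i <;> simp [hc]

/-- `diag(1, c)·diag(1, c⁻¹) = 1` for `c ≠ 0` (the other order). [cite: LabesseLanglands1979, §2 p. 8] -/
theorem diagonal_mul_diagonal_inv {c : K} (hc : c ≠ 0) :
    Matrix.diagonal ![(1 : K), c] * Matrix.diagonal ![1, c⁻¹] = 1 := by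
  rw [Matrix.diagonal_mul_diagonal, ← Matrix.diagonal_one]
  congr 1
  funext i
  fin_cases i <;> simp [hc]

/-- **LL (2.1): the element `γ = a + bτ` read at a diagonal representative `diag(1, c)`, `c ≠ 0` (`c = ϖ^m`).**
`diag(1, c⁻¹)·(a, bv; b, a + bu)·diag(1, c) = (a, b v c; b c⁻¹, a + b u)`. [cite: LabesseLanglands1979, §2 (2.1) p. 8] -/
theorem diagonal_inv_mul_regRep_mul_diagonal' (c : K) (hc : c ≠ 0) (a b : K) :
    Matrix.diagonal ![(1 : K), c⁻¹] * !![a, b * v; b, a + b * u] * Matrix.diagonal ![1, c] = !![a, b * v * c; b * c⁻¹, a + b * u] := by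
  ext i j
  fin_cases i <;> fin_cases j
  · simp
  · simp
  · simp [mul_comm]
  · simp
    rw [mul_comm, ← mul_assoc, mul_inv_cancel₀ hc, one_mul]

/-- **LL (2.1): the element `γ = a + bτ` read at the shell-`m` representative `diag(1, ϖ^m)`** (`ϖ ≠ 0`):
`diag(1, (ϖ^m)⁻¹)·(a, bv; b, a + bu)·diag(1, ϖ^m) = (a, b v ϖ^m; b (ϖ^m)⁻¹, a + b u)` — formula (2.1)'s matrix. [cite: LabesseLanglands1979, §2 (2.1) p. 8] -/
theorem diagonal_inv_mul_regRep_mul_diagonal (ϖ : K) (hϖ : ϖ ≠ 0) (m : ℕ) (a b : K) :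
    Matrix.diagonal ![(1 : K), (ϖ ^ m)⁻¹] * !![a, b * v; b, a + b * u] * Matrix.diagonal ![1, ϖ ^ m] =
      !![a, b * v * ϖ ^ m; b * (ϖ ^ m)⁻¹, a + b * u] :=
  diagonal_inv_mul_regRep_mul_diagonal' u v (ϖ ^ m) (pow_ne_zero m hϖ) a b

/-- The shell conjugate is again of «regular-representation type» for the RESCALED basis `{1, ϖ^{−m}τ}`: `(a, b′v′; b′, a + b′u′)` with `b′ = b(ϖ^m)⁻¹`,
`u′ = u ϖ^m`, `v′ = v ϖ^{2m}` (so §1 applies verbatim at every shell). [cite: LabesseLanglands1979, §2 (2.1) p. 8] -/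
theorem shellConj_eq_regRep (ϖ : K) (hϖ : ϖ ≠ 0) (m : ℕ) (a b : K) :
    !![a, b * v * ϖ ^ m; b * (ϖ ^ m)⁻¹, a + b * u] =
      !![a, (b * (ϖ ^ m)⁻¹) * (v * ϖ ^ (2 * m)); b * (ϖ ^ m)⁻¹, a + (b * (ϖ ^ m)⁻¹) * (u * ϖ ^ m)] := by
  have hm : ϖ ^ m ≠ 0 := pow_ne_zero m hϖ
  have h1 : b * v * ϖ ^ m = (b * (ϖ ^ m)⁻¹) * (v * ϖ ^ (2 * m)) := by
    field_simp
    ring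
  have h2 : a + b * u = a + (b * (ϖ ^ m)⁻¹) * (u * ϖ ^ m) := by field_simp
  rw [← h1, ← h2]

end Field

/-! ## §3 Integrality and congruence class of the shell conjugate (valued field) -/

section Valued

variable {K : Type*} [Field K] {Γ₀ : Type*} [LinearOrderedCommGroupWithZero Γ₀] [hK : Valued K Γ₀]

/-- **Integrality of the shell-`m` conjugate** (LL p. 8: «it is clear that `m` is uniquely determined» ∕ the fixed set is a ball): for `a, u, v, b` integral and
`0 < |ϖ| ≤ 1`, ALL entries of `(a, b v ϖ^m; b (ϖ^m)⁻¹, a + b u)` are integral iff `|b| ≤ |ϖ|^m` — «`γ = a + bτ` stabilises the lattice `𝒪 ⊕ ϖ^m𝒪τ` iff `m ≤ ord b`».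
[cite: LabesseLanglands1979, §2 p. 8] -/
theorem forall_v_shellConj_le_one_iff (u v : K) (hu : Valued.v u ≤ 1) (hv : Valued.v v ≤ 1) (ϖ : K) (hϖ0 : ϖ ≠ 0) (hϖ : Valued.v ϖ ≤ 1) (m : ℕ)
    (a b : K) (ha : Valued.v a ≤ 1) (hb : Valued.v b ≤ 1) :
    (∀ i j, Valued.v (!![a, b * v * ϖ ^ m; b * (ϖ ^ m)⁻¹, a + b * u] i j) ≤ 1) ↔ Valued.v b ≤ Valued.v ϖ ^ m := by
  have hm0 : Valued.v (ϖ ^ m) ≠ 0 := by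
    rw [map_pow]; exact pow_ne_zero m ((Valuation.ne_zero_iff _).2 hϖ0)
  have hkey : Valued.v (b * (ϖ ^ m)⁻¹) ≤ 1 ↔ Valued.v b ≤ Valued.v ϖ ^ m := by
    rw [map_mul, map_inv₀, mul_inv_le_iff₀ (zero_lt_iff.2 hm0), one_mul, map_pow]
  have hϖm : Valued.v (ϖ ^ m) ≤ 1 := by rw [map_pow]; exact pow_le_one' hϖ m
  constructor
  · intro h
    exact hkey.1 (by simpa using h 1 0)
  · intro h i j
    fin_cases i <;> fin_cases j
    · simpa using ha
    · show Valued.v (b * v * ϖ ^ m) ≤ 1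
      rw [map_mul, map_mul]
      exact mul_le_one' (mul_le_one' hb hv) hϖm
    · simpa using hkey.2 h
    · show Valued.v (a + b * u) ≤ 1
      refine le_trans (Valuation.map_add _ _ _) (max_le ha ?_)
      rw [map_mul]; exact mul_le_one' hb hu

/-- **The class at a shell-`m` vertex modulo the level `j`** (the dyadic-safe replacement of the tame road's «bit»): if `u, v` are integral, `0 < |ϖ| ≤ 1`, and
`|a − a′| ≤ |ϖ|^j`, `|b(ϖ^m)⁻¹ − b′(ϖ^m)⁻¹| ≤ |ϖ|^j`, then the two shell-`m` conjugates are congruent modulo `ϖ^j` ENTRYWISE — the `K(j)`-class of `γ` read at the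
shell-`m` vertex depends on `γ = a + bτ` only through `(a, b ϖ^{−m})` modulo `𝔭^j`. [cite: LabesseLanglands1979, §2 (2.1) p. 8; p. 9 «f(a, b²v∕x; x, a+bu) = f(a₀, 0; x, a₀)»] -/
theorem forall_v_shellConj_sub_le (u v : K) (hu : Valued.v u ≤ 1) (hv : Valued.v v ≤ 1) (ϖ : K) (hϖ0 : ϖ ≠ 0) (hϖ : Valued.v ϖ ≤ 1) (m j : ℕ)
    (a b a' b' : K) (ha : Valued.v (a - a') ≤ Valued.v ϖ ^ j) (hb : Valued.v (b * (ϖ ^ m)⁻¹ - b' * (ϖ ^ m)⁻¹) ≤ Valued.v ϖ ^ j) :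
    ∀ i k, Valued.v (!![a, b * v * ϖ ^ m; b * (ϖ ^ m)⁻¹, a + b * u] i k - !![a', b' * v * ϖ ^ m; b' * (ϖ ^ m)⁻¹, a' + b' * u] i k) ≤ Valued.v ϖ ^ j := by
  have hm : ϖ ^ m ≠ 0 := pow_ne_zero m hϖ0
  have hϖm : Valued.v (ϖ ^ m) ≤ 1 := by rw [map_pow]; exact pow_le_one' hϖ m
  -- `b − b′ = (bϖ^{−m} − b′ϖ^{−m})·ϖ^m`, hence `|b − b′| ≤ |ϖ|^j`
  have hbb : b - b' = (b * (ϖ ^ m)⁻¹ - b' * (ϖ ^ m)⁻¹) * ϖ ^ m := by field_simp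
  have hbb' : Valued.v (b - b') ≤ Valued.v ϖ ^ j := by
    rw [hbb, map_mul]
    calc Valued.v (b * (ϖ ^ m)⁻¹ - b' * (ϖ ^ m)⁻¹) * Valued.v (ϖ ^ m) ≤ Valued.v ϖ ^ j * 1 := mul_le_mul' hb hϖm
      _ = Valued.v ϖ ^ j := mul_one _
  intro i k
  fin_cases i <;> fin_cases k
  · simpa using ha
  · show Valued.v (b * v * ϖ ^ m - b' * v * ϖ ^ m) ≤ Valued.v ϖ ^ j
    have h : b * v * ϖ ^ m - b' * v * ϖ ^ m = (b - b') * (v * ϖ ^ m) := by ring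
    rw [h, map_mul, map_mul]
    calc Valued.v (b - b') * (Valued.v v * Valued.v (ϖ ^ m)) ≤ Valued.v ϖ ^ j * 1 := mul_le_mul' hbb' (mul_le_one' hv hϖm)
      _ = Valued.v ϖ ^ j := mul_one _
  · simpa using hb
  · show Valued.v (a + b * u - (a' + b' * u)) ≤ Valued.v ϖ ^ j
    have h : a + b * u - (a' + b' * u) = (a - a') + (b - b') * u := by ring
    rw [h]
    refine le_trans (Valuation.map_add _ _ _) (max_le ha ?_)
    rw [map_mul]
    calc Valued.v (b - b') * Valued.v u ≤ Valued.v ϖ ^ j * 1 := mul_le_mul' hbb' hu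
      _ = Valued.v ϖ ^ j := mul_one _

/-- **Determinant of the shell conjugate** = `det γ` (it is a conjugate), in closed form `a² + abu − b²v`. [cite: LabesseLanglands1979, §2 p. 8] -/
theorem det_shellConj (u v ϖ : K) (hϖ : ϖ ≠ 0) (m : ℕ) (a b : K) :
    (!![a, b * v * ϖ ^ m; b * (ϖ ^ m)⁻¹, a + b * u]).det = a ^ 2 + a * b * u - b ^ 2 * v := by
  have hm : ϖ ^ m ≠ 0 := pow_ne_zero m hϖ
  rw [Matrix.det_fin_two_of]
  field_simp

end Valued

/-! ## §4 Conjugation by `diag(1, y)` — the `K`-renormalisation ∕ partner twist `Conj_y` and LL p. 9's normal form `(a, b²v∕x; x, a + bu)` (ED. 2)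

ED. 2 (g1), cut on request of B-p14 (g33)'s (B6-V) census «THE VALUE LAWS ON THE TORUS» (e5b7e34669b2ff57, §1): `Conj_y(S) := diag(1, y)⁻¹·S·diag(1, y)`
(`= (p, q y; r y⁻¹, s)` for `S = (p, q; r, s)`), its composition law `Conj_{y′} ∘ Conj_y = Conj_{y y′}`, `Conj_y` of the shell-`m` conjugate, and — for
`y·(r·ϖ^n) = b` (`y = β₁ = b ϖ^{−n}`, resp. `y = β₁∕r` with `r = u_F` the partner's non-norm unit) — the `β₁`-FREE normal forms `(a, b v ϖ^m y; r ϖ^n ϖ^{−m}, a + bu)`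
= LL p. 9's `(a, b²v∕x; x, a + bu)` with `x = r ϖ^{n−m}`.  Place-blind field algebra; no hypothesis on `2`. -/

section Conj

variable {K : Type*} [Field K] (u v : K)

/-- The inverse MATRIX of `diag(1, y)` (`y ≠ 0`) is `diag(1, y⁻¹)` — so for `D = diag(1, y) ∈ GL₂` the coercion of `D⁻¹` is `diag(1, y⁻¹)` and §2∕§4 apply to `D⁻¹·g·D`.
[cite: LabesseLanglands1979, §2 p. 8] -/
theorem inv_diagonal_one_eq {y : K} (hy : y ≠ 0) : (Matrix.diagonal ![(1 : K), y])⁻¹ = Matrix.diagonal ![1, y⁻¹] :=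
  Matrix.inv_eq_left_inv (diagonal_inv_mul_diagonal hy)

/-- `diag(1, y)·diag(1, y′) = diag(1, y y′)` (the diagonal torus `{diag(1, ·)}` is a homomorphic image of `Kˣ`). [cite: LabesseLanglands1979, §2 p. 8] -/
theorem diagonal_one_mul_diagonal_one (y y' : K) :
    Matrix.diagonal ![(1 : K), y] * Matrix.diagonal ![1, y'] = Matrix.diagonal ![1, y * y'] := by
  rw [Matrix.diagonal_mul_diagonal]
  congr 1
  funext i
  fin_cases i <;> simp

/-- **`Conj_y` ENTRYWISE**: `diag(1, y⁻¹)·(p, q; r, s)·diag(1, y) = (p, q y; r y⁻¹, s)` for `y ≠ 0` (B-p14's `Conj_y(S) = (1, p y; r∕y, d)`).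
[cite: LabesseLanglands1979, §2 (2.1)–(2.2) pp. 8–9] -/
theorem diagonal_inv_mul_fin_two_mul_diagonal {y : K} (hy : y ≠ 0) (p q r s : K) :
    Matrix.diagonal ![(1 : K), y⁻¹] * !![p, q; r, s] * Matrix.diagonal ![1, y] = !![p, q * y; r * y⁻¹, s] := by
  ext i j
  fin_cases i <;> fin_cases j
  · simp
  · simp
  · simp [mul_comm]
  · simp
    rw [mul_comm, ← mul_assoc, mul_inv_cancel₀ hy, one_mul]

/-- The opposite twist `Conj_{y⁻¹}`: `diag(1, y)·(p, q; r, s)·diag(1, y⁻¹) = (p, q y⁻¹; r y, s)` (`y ≠ 0`) — the shape of the partner relation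
`E₂(e a) = D_u·E₂(a)·D_u⁻¹`, `D_u = diag(1, u)`. [cite: LabesseLanglands1979, §2 (2.2) p. 9] -/
theorem diagonal_mul_fin_two_mul_diagonal_inv {y : K} (hy : y ≠ 0) (p q r s : K) :
    Matrix.diagonal ![(1 : K), y] * !![p, q; r, s] * Matrix.diagonal ![1, y⁻¹] = !![p, q * y⁻¹; r * y, s] := by
  have h := diagonal_inv_mul_fin_two_mul_diagonal (inv_ne_zero hy) p q r s
  rwa [inv_inv] at h

/-- **COMPOSITION `Conj_{y′} ∘ Conj_y = Conj_{y y′}`** for ANY `2 × 2` matrix `S` (a formal identity: no non-vanishing needed, `(y y′)⁻¹ = y′⁻¹ y⁻¹`).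
[cite: LabesseLanglands1979, §2 (2.2) p. 9] -/
theorem conjDiag_conjDiag (y y' : K) (S : Matrix (Fin 2) (Fin 2) K) :
    Matrix.diagonal ![(1 : K), y'⁻¹] * (Matrix.diagonal ![1, y⁻¹] * S * Matrix.diagonal ![1, y]) * Matrix.diagonal ![1, y'] =
      Matrix.diagonal ![1, (y * y')⁻¹] * S * Matrix.diagonal ![1, y * y'] := by
  calc Matrix.diagonal ![(1 : K), y'⁻¹] * (Matrix.diagonal ![1, y⁻¹] * S * Matrix.diagonal ![1, y]) * Matrix.diagonal ![1, y']
      = (Matrix.diagonal ![(1 : K), y'⁻¹] * Matrix.diagonal ![1, y⁻¹]) * S * (Matrix.diagonal ![1, y] * Matrix.diagonal ![1, y']) := by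
        simp only [Matrix.mul_assoc]
    _ = Matrix.diagonal ![1, (y * y')⁻¹] * S * Matrix.diagonal ![1, y * y'] := by
        rw [diagonal_one_mul_diagonal_one, diagonal_one_mul_diagonal_one, _root_.mul_inv_rev]

/-- **(g1) `Conj_y` OF THE SHELL-`m` CONJUGATE** (LL (2.1) read after the `K`-renormalisation by the lift of `diag(1, y)`, `y ≠ 0`):
`diag(1, y⁻¹)·(a, b v ϖ^m; b (ϖ^m)⁻¹, a + b u)·diag(1, y) = (a, b v ϖ^m y; b (ϖ^m)⁻¹ y⁻¹, a + b u)`. [cite: LabesseLanglands1979, §2 (2.1)–(2.2) pp. 8–9] -/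
theorem diagonal_inv_mul_shellConj_mul_diagonal (ϖ : K) (m : ℕ) (a b : K) {y : K} (hy : y ≠ 0) :
    Matrix.diagonal ![(1 : K), y⁻¹] * !![a, b * v * ϖ ^ m; b * (ϖ ^ m)⁻¹, a + b * u] * Matrix.diagonal ![1, y] =
      !![a, b * v * ϖ ^ m * y; b * (ϖ ^ m)⁻¹ * y⁻¹, a + b * u] :=
  diagonal_inv_mul_fin_two_mul_diagonal hy _ _ _ _

/-- The same in ONE step from `γ = a + bτ`: conjugating the regular representation by `diag(1, ϖ^m y)` (`ϖ, y ≠ 0`) gives `(a, b v ϖ^m y; b (ϖ^m)⁻¹ y⁻¹, a + b u)` —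
the descent datum `D := diag(1, c^m y)` of the renormalised shell element. [cite: LabesseLanglands1979, §2 (2.1)–(2.2) pp. 8–9] -/
theorem diagonal_inv_mul_regRep_mul_diagonal_mul (ϖ : K) (hϖ : ϖ ≠ 0) (m : ℕ) (a b : K) {y : K} (hy : y ≠ 0) :
    Matrix.diagonal ![(1 : K), (ϖ ^ m * y)⁻¹] * !![a, b * v; b, a + b * u] * Matrix.diagonal ![1, ϖ ^ m * y] =
      !![a, b * v * ϖ ^ m * y; b * (ϖ ^ m)⁻¹ * y⁻¹, a + b * u] := by
  have h1 : b * v * (ϖ ^ m * y) = b * v * ϖ ^ m * y := by ring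
  have h2 : b * (ϖ ^ m * y)⁻¹ = b * (ϖ ^ m)⁻¹ * y⁻¹ := by rw [_root_.mul_inv_rev]; ring
  rw [diagonal_inv_mul_regRep_mul_diagonal' u v (ϖ ^ m * y) (mul_ne_zero (pow_ne_zero m hϖ) hy), h1, h2]

/-- **LL p. 9's NORMAL FORM `(a, b²v∕x; x, a + bu)`**: if `y·(r·ϖ^n) = b` with `y, r ≠ 0` (`y = β₁∕r`, `β₁ := b ϖ^{−n}` the unit part of `b` when `n = ord b`,
`r = 1` for `t` itself and `r = u_F` — the non-norm unit — for the partner `e t`), then `Conj_y` of the shell-`m` conjugate is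
`(a, b v ϖ^m y; r·(ϖ^n (ϖ^m)⁻¹), a + b u)`: the lower-left entry `x = r ϖ^{n−m}` NO LONGER INVOLVES `b` — on the window `m = n − j + i` both normal forms are
continuous in `γ` through `b = 0`. [cite: LabesseLanglands1979, §2 (2.2) p. 9] -/
theorem diagonal_inv_mul_shellConj_mul_diagonal_of_mul_eq (ϖ : K) (m n : ℕ) (a b r y : K) (hr : r ≠ 0) (hy : y ≠ 0) (hyb : y * (r * ϖ ^ n) = b) :
    Matrix.diagonal ![(1 : K), y⁻¹] * !![a, b * v * ϖ ^ m; b * (ϖ ^ m)⁻¹, a + b * u] * Matrix.diagonal ![1, y] =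
      !![a, b * v * ϖ ^ m * y; r * (ϖ ^ n * (ϖ ^ m)⁻¹), a + b * u] := by
  rw [diagonal_inv_mul_shellConj_mul_diagonal u v ϖ m a b hy]
  have h : b * (ϖ ^ m)⁻¹ * y⁻¹ = r * (ϖ ^ n * (ϖ ^ m)⁻¹) := by
    rw [← hyb]
    field_simp
  rw [h]

/-- **Normal form A** (`y = β₁ = b (ϖ^n)⁻¹`, `b, ϖ ≠ 0`): `Conj_{b ϖ^{−n}}` of the shell-`m` conjugate is `(a, b² v (ϖ^m (ϖ^n)⁻¹); ϖ^n (ϖ^m)⁻¹, a + b u)` —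
B-p14's `A_i(t) = (1, β² v₀ c^{i−j}; c^{j−i}, 1 + β u₀)` for `a = 1`, `m − n = i − j`. [cite: LabesseLanglands1979, §2 (2.2) p. 9] -/
theorem conj_shellConj_eq_normalFormA (ϖ : K) (hϖ : ϖ ≠ 0) (m n : ℕ) (a b : K) (hb : b ≠ 0) :
    Matrix.diagonal ![(1 : K), (b * (ϖ ^ n)⁻¹)⁻¹] * !![a, b * v * ϖ ^ m; b * (ϖ ^ m)⁻¹, a + b * u] * Matrix.diagonal ![1, b * (ϖ ^ n)⁻¹] =
      !![a, b ^ 2 * v * (ϖ ^ m * (ϖ ^ n)⁻¹); ϖ ^ n * (ϖ ^ m)⁻¹, a + b * u] := by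
  have hn : ϖ ^ n ≠ 0 := pow_ne_zero n hϖ
  have hy : b * (ϖ ^ n)⁻¹ ≠ 0 := mul_ne_zero hb (inv_ne_zero hn)
  rw [diagonal_inv_mul_shellConj_mul_diagonal_of_mul_eq u v ϖ m n a b 1 (b * (ϖ ^ n)⁻¹) one_ne_zero hy (by field_simp), one_mul]
  have h : b * v * ϖ ^ m * (b * (ϖ ^ n)⁻¹) = b ^ 2 * v * (ϖ ^ m * (ϖ ^ n)⁻¹) := by ring
  rw [h]

/-- **Normal form B** (`y = β₁∕r = b (ϖ^n)⁻¹ r⁻¹`, `b, ϖ, r ≠ 0`, `r = u_F`): `Conj_y` of the shell-`m` conjugate is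
`(a, b² v (ϖ^m (ϖ^n)⁻¹) r⁻¹; r (ϖ^n (ϖ^m)⁻¹), a + b u)` — B-p14's `B_i(t) = (1, β² v₀ c^{i−j}∕u_F; u_F c^{j−i}, 1 + β u₀)`. [cite: LabesseLanglands1979, §2 (2.2) p. 9] -/
theorem conj_shellConj_eq_normalFormB (ϖ : K) (hϖ : ϖ ≠ 0) (m n : ℕ) (a b r : K) (hb : b ≠ 0) (hr : r ≠ 0) :
    Matrix.diagonal ![(1 : K), (b * (ϖ ^ n)⁻¹ * r⁻¹)⁻¹] * !![a, b * v * ϖ ^ m; b * (ϖ ^ m)⁻¹, a + b * u] *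
        Matrix.diagonal ![1, b * (ϖ ^ n)⁻¹ * r⁻¹] =
      !![a, b ^ 2 * v * (ϖ ^ m * (ϖ ^ n)⁻¹) * r⁻¹; r * (ϖ ^ n * (ϖ ^ m)⁻¹), a + b * u] := by
  have hn : ϖ ^ n ≠ 0 := pow_ne_zero n hϖ
  have hy : b * (ϖ ^ n)⁻¹ * r⁻¹ ≠ 0 := mul_ne_zero (mul_ne_zero hb (inv_ne_zero hn)) (inv_ne_zero hr)
  rw [diagonal_inv_mul_shellConj_mul_diagonal_of_mul_eq u v ϖ m n a b r (b * (ϖ ^ n)⁻¹ * r⁻¹) hr hy (by field_simp)]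
  have h : b * v * ϖ ^ m * (b * (ϖ ^ n)⁻¹ * r⁻¹) = b ^ 2 * v * (ϖ ^ m * (ϖ ^ n)⁻¹) * r⁻¹ := by ring
  rw [h]

end Conj

end Literature.NumberTheory.LocalFields.QuadraticRegularRep
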